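import Summits.HubbardSuperconductivity.HubbardLadder.Bounds.TwistInsensitivityCatalan
import Literature.MathematicalPhysics.StatisticalMechanics.KosterlitzThoulessStiffnessBound
import HarnessLib

/-!
# Ventures/CertifiedManyBodySolver — Observables/HighTemperatureNoTransition.lean

HONEST FRAMING: the ONE assumption-free temperature statement the `hubbard-tc` cell can print today — a «not superconducting
(no thermal phase stiffness) above `T* = 610·(1 + |t′/t|)·t`» reading of pub-hubbard's kernel-proved high-temperature cluster
expansion (`Bounds/TwistInsensitivityCatalan.lean`, node `HighTemperatureNoThermalStiffnessTT'At610`, 0 sorry), WITHOUT the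
Nelson–Kosterlitz input (key K2), without monotonicity (K3) and for EVERY interaction `U` and chemical potential `μ`. The number is
absurd as a kelvin figure (`T* ≈ 10³·t`, three to four orders above the K2-conditional ceilings `≈ 0.3·t`): this file exists to give
the phase-map `T` axis its certified, hypothesis-free top cell, not to compete with any row. GRAND-CANONICAL ensemble (the cluster
expansion's); the cell's canonical `(N_L, S^z = 0)`-sector leaves (`StiffnessThermalLeaf.lean`) are a different object and are NOT
touched. Not a `T_c` estimate; a ceiling never speaks to the presence of order.

Cell `hubbard-tc` (MO-S3, D-0096), seat p1, `prover-hubbard-tc-p1-g4-0`; lead RULING 2026-08-27T04:30Z (2) «GO, low priority, one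
lemma + one TC-TABLE footnote, no rows».

* §1 `gcFluxLogZ L tp U μ β θ` — the grand-canonical log-partition function `log Re Z_L(θ)` of the seam-twisted `t–t′` torus at
  chemical potential `μ` (`Z_L(θ) = partitionFn β (hubbardTorusTT'FluxMu L t′ U μ θ)`, the Bounds object).
* §2 `IsGCThermalFluxStiffnessSeqAt tp U μ β ρ` — the grand-canonical twin of `IsThermalFluxStiffnessSeqAt` (key K1t shape): `ρ` is
  (at most) a thermal flux-stiffness constant of the grand-canonical free energy at inverse temperature `β` — every level `0 < r < ρ`
  obeys `β r θ² ≤ log Re Z_L(0) − log Re Z_L(θ)` on a window `|θ| ≤ θ₀` along some sequence of sides `L_j → ∞`.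
* §3 `IsGCThermalFluxStiffnessSeqAt.nonpos_of_le_inv_610` — **no thermal stiffness at `T ≥ 610(1+|t′|)`**: if `β(1+|t′|) ≤ 1/610`
  then every identified `ρ` is `≤ 0` (the Bounds node gives `r ≤ 2L²e^{−L/1000}/(βθ₀²)` at every side `L ≥ 3`, and the right side
  tends to `0`).
* §4 `GCStiffnessTransitionAt tp U μ ρₑ Tc` (a profile positive on `(0, Tc)` and identified there — NO stability / universal-jump
  field) and **`GCStiffnessTransitionAt.le_mul` : `Tc ≤ 610·(1+|t′|)`**; the same from the Literature predicate
  `KosterlitzThouless.IsTransitionAt` (`le_mul_of_isTransitionAt`). K2-free, K3-free, every `U`, every `μ`.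

References: D. Ueltschi, J. Stat. Phys. 95 (1999) 693, §2.3 [Ueltschi1999]; R. Kotecký, D. Preiss, Comm. Math. Phys. 103 (1986)
491 [KoteckyPreiss1986]; D. R. Nelson, in Defects and Geometry in Condensed Matter Physics (2002) §6.2 [Nelson2002Defects].
-/

noncomputable section

namespace Summit.Ventures.CertifiedManyBodySolver.Observables

open Filter Topology Real Matrix
open Summit.HubbardSuperconductivity.HubbardLadder.Bounds
open Literature.MathematicalPhysics.QuantumLattice Literature.MathematicalPhysics.QuantumFieldTheory
open Literature.MathematicalPhysics.StatisticalMechanics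

/-! ## §1 The grand-canonical twisted log-partition function -/

/-- The grand-canonical log-partition function `log Re Z_L(θ)` of the seam-twisted `t–t′` Hubbard torus of side `L` at inverse
temperature `β`, chemical potential `μ`, twist `θ` (`Z_L(θ) = Tr e^{−β(H^{tt′}_L(t′,U;θ) − μN)}`, the object of pub-hubbard's
Theorem 12). [cite: Ueltschi1999, §2.3 (polymer expansion of the grand-canonical partition function)] -/
def gcFluxLogZ (L : ℕ) [NeZero L] (tp U μ β θ : ℝ) : ℝ :=
  Real.log (partitionFn β (hubbardTorusTT'FluxMu L tp U μ θ)).re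

/-! ## §2 The grand-canonical thermal identification -/

/-- **Grand-canonical thermal flux-stiffness identification** (the K1t shape of `IsThermalFluxStiffnessSeqAt`, grand-canonical
ensemble): `ρ` is (at most) a thermal flux-stiffness constant at inverse temperature `β` — every level `0 < r < ρ` satisfies the
thermal flux inequality `β r θ² ≤ log Re Z_L(0) − log Re Z_L(θ)` on some window `|θ| ≤ θ₀` along some sequence of sides
`L_j → ∞`. A DEFINITION of what it means for a profile value to be a stiffness of this model; no physics input.
[cite: ScalapinoWhiteZhang1993, §II (stiffness as the curvature of the free energy under a flux twist)] -/
def IsGCThermalFluxStiffnessSeqAt (tp U μ β ρ : ℝ) : Prop :=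
  ∀ r : ℝ, 0 < r → r < ρ → ∃ θ₀ : ℝ, 0 < θ₀ ∧ ∃ Ls : ℕ → ℕ, Tendsto Ls atTop atTop ∧
    ∀ (j : ℕ) [NeZero (Ls j)] (θ : ℝ), |θ| ≤ θ₀ →
      β * r * θ ^ 2 ≤ gcFluxLogZ (Ls j) tp U μ β 0 - gcFluxLogZ (Ls j) tp U μ β θ

/-- The identification is monotone in the level. [cite: ScalapinoWhiteZhang1993, §II] -/
theorem IsGCThermalFluxStiffnessSeqAt.mono {tp U μ β ρ ρ' : ℝ} (h : IsGCThermalFluxStiffnessSeqAt tp U μ β ρ)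
    (hle : ρ' ≤ ρ) : IsGCThermalFluxStiffnessSeqAt tp U μ β ρ' :=
  fun r hr hrρ => h r hr (hrρ.trans_le hle)

/-! ## §3 No thermal stiffness above `T* = 610(1 + |t′|)` -/

/-- The twist-insensitivity tail `2L²e^{−L/1000} → 0` along the naturals. [cite: KoteckyPreiss1986, Theorem p. 492 (exponential tail of the cluster expansion)] -/
theorem tendsto_twistTail_zero :
    Tendsto (fun L : ℕ => 2 * (L : ℝ) ^ 2 * Real.exp (-((1 / 1000) * (L : ℝ)))) atTop (𝓝 0) := by
  have t1 : Tendsto (fun x : ℝ => x ^ 2 * Real.exp (-((1 / 1000) * x))) atTop (𝓝 0) := by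
    refine (tendsto_rpow_mul_exp_neg_mul_atTop_nhds_zero 2 (1 / 1000) (by norm_num)).congr ?_
    intro x
    rw [show (2 : ℝ) = ((2 : ℕ) : ℝ) by norm_num, Real.rpow_natCast, neg_mul]
  have t2 := t1.const_mul 2
  rw [mul_zero] at t2
  refine (t2.comp tendsto_natCast_atTop_atTop).congr fun L => ?_
  simp only [Function.comp]
  ring

/-- **No grand-canonical thermal phase stiffness at `T ≥ 610(1 + |t′|)·t`, for every `U` and `μ`** (K2-free, K3-free): if
`β > 0`, `β(1 + |t′|) ≤ 1/610` and `ρ` is identified as a thermal flux-stiffness constant at `β`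
(`IsGCThermalFluxStiffnessSeqAt`), then `ρ ≤ 0`. From pub-hubbard's kernel theorem
`highTemperatureNoThermalStiffnessTT'At610_holds`: every such level `r` obeys `r ≤ 2L²e^{−L/1000}/(βθ₀²)` at every side `L ≥ 3`
of its sequence, and the right side tends to `0`. [cite: Ueltschi1999, §2.3 and Thm 3.1 (analyticity / cluster expansion at high temperature, uniformly in U)] -/
theorem IsGCThermalFluxStiffnessSeqAt.nonpos_of_le_inv_610 {tp U μ β ρ : ℝ} (h : IsGCThermalFluxStiffnessSeqAt tp U μ β ρ)
    (hβ : 0 < β) (hT : β * (1 + |tp|) ≤ 1 / 610) : ρ ≤ 0 := by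
  by_contra hρ
  push Not at hρ
  obtain ⟨θ₀, hθ₀, Ls, hLs, hst⟩ := h (ρ / 2) (half_pos hρ) (half_lt_self hρ)
  have htail := tendsto_twistTail_zero.comp hLs
  have hpos : 0 < β * (ρ / 2) * θ₀ ^ 2 := by positivity
  have hev3 : ∀ᶠ j in atTop, 3 ≤ Ls j := (tendsto_atTop.1 hLs) 3
  have hevsmall : ∀ᶠ j in atTop,
      2 * ((Ls j : ℕ) : ℝ) ^ 2 * Real.exp (-((1 / 1000) * ((Ls j : ℕ) : ℝ))) < β * (ρ / 2) * θ₀ ^ 2 :=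
    (tendsto_order.1 htail).2 _ hpos
  obtain ⟨j, hj3, hjsmall⟩ := (hev3.and hevsmall).exists
  haveI : NeZero (Ls j) := ⟨by omega⟩
  have hnode := highTemperatureNoThermalStiffnessTT'At610_holds (Ls j) hj3 tp U μ β (ρ / 2) θ₀ hβ hθ₀ hT
    (fun θ hθ => by simpa only [gcFluxLogZ] using hst j θ hθ)
  -- `ρ/2 ≤ tail/(βθ₀²)` contradicts `tail < β(ρ/2)θ₀²`
  have hden : 0 < β * θ₀ ^ 2 := by positivity
  rw [le_div_iff₀ hden] at hnode
  nlinarith [hnode, hjsmall]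

/-! ## §4 The K2-free transition bound -/

/-- **A grand-canonical thermal stiffness profile with a candidate transition at `Tc`, WITHOUT any Kosterlitz–Thouless input**:
`ρₑ` is positive on `(0, Tc)` (`pos_below`) and each value `ρₑ(T)`, `T ∈ (0, Tc)`, is identified as a thermal flux-stiffness
constant of the model at `β = 1/T` (`thermal`). No stability inequality, no universal jump, no monotonicity.
[cite: Nelson2002Defects, §6.2 Fig. 6.2 (the transition read off the vanishing of the superfluid density)] -/
structure GCStiffnessTransitionAt (tp U μ : ℝ) (ρe : ℝ → ℝ) (Tc : ℝ) : Prop where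
  /-- the profile is positive below `Tc` -/
  pos_below : ∀ ⦃T : ℝ⦄, 0 < T → T < Tc → 0 < ρe T
  /-- K1t shape, grand-canonical: `ρₑ(T)` is a thermal flux-stiffness constant at `β = 1/T` -/
  thermal : ∀ ⦃T : ℝ⦄, 0 < T → T < Tc → IsGCThermalFluxStiffnessSeqAt tp U μ (1 / T) (ρe T)

/-- **`Tc ≤ 610·(1 + |t′|)` with NO Kosterlitz–Thouless hypothesis** (tree units `t = 1`, `k_B = 1`; every `U`, every `μ`): were
`Tc` larger, the profile would be positive at `T* = 610(1+|t′|)`, where §3 forces every identified stiffness to vanish. The cell's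
ONLY assumption-free «not SC above `T*`» statement (`T* ≈ 10³·t`). [cite: Ueltschi1999, §2.3 and Thm 3.1] -/
theorem GCStiffnessTransitionAt.le_mul {tp U μ : ℝ} {ρe : ℝ → ℝ} {Tc : ℝ} (h : GCStiffnessTransitionAt tp U μ ρe Tc) :
    Tc ≤ 610 * (1 + |tp|) := by
  by_contra hlt
  push Not at hlt
  set Ts : ℝ := 610 * (1 + |tp|) with hTs
  have hTs0 : 0 < Ts := by positivity
  have hρ : 0 < ρe Ts := h.pos_below hTs0 hlt
  have hth := h.thermal hTs0 hlt
  have hβT : 1 / Ts * (1 + |tp|) ≤ 1 / 610 := by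
    rw [hTs]
    have h1 : 0 < 1 + |tp| := by positivity
    field_simp
    rfl
  have := hth.nonpos_of_le_inv_610 (by positivity) hβT
  linarith

/-- The same bound phrased with the Literature predicate `KosterlitzThouless.IsTransitionAt` (positive below `Tc`, zero above)
and the grand-canonical identification on `(0, Tc)`: `Tc ≤ 610·(1 + |t′|)`, K2-free.
[cite: Nelson2002Defects, §6.2 Fig. 6.2] -/
theorem le_mul_of_isTransitionAt {tp U μ : ℝ} {ρe : ℝ → ℝ} {Tc : ℝ} (hI : KosterlitzThouless.IsTransitionAt ρe Tc)
    (hth : ∀ ⦃T : ℝ⦄, 0 < T → T < Tc → IsGCThermalFluxStiffnessSeqAt tp U μ (1 / T) (ρe T)) :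
    Tc ≤ 610 * (1 + |tp|) :=
  GCStiffnessTransitionAt.le_mul ⟨fun _ hT hTTc => hI.1 hT hTTc, hth⟩

end Summit.Ventures.CertifiedManyBodySolver.Observables

end
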